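import Literature.AlgebraicGeometry.Frobenioids.Cor412Unconditional
import Literature.AlgebraicGeometry.Frobenioids.EquivalencePreStepsFSMFF2008Assembly
import HarnessLib

/-!
# Frobenioids I, Corollary 4.12 AS PRINTED — for every pair of Frobenioids, with NO base-type hypothesis
# beyond print's own antecedents and NO named fact

Mochizuki, *The geometry of Frobenioids I: the general theory*, Kyushu J. Math. **62** (2008) 293–400,
kurims text, Cor. 4.12 (Category-theoreticity of the functor to an elementary Frobenioid II), statement
p. 94 l. 44 – p. 95 l. 17, proof p. 95 ll. 18–40 [cite: MochizukiFrdI2008, Cor. 4.12 p.95]: for Frobenioids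
`C_i → F_{Φ_i}` whose base categories `D_i` are Frobenius-slim and which are of rationally standard type, and an
equivalence `Ψ : C₁ ⥲ C₂` satisfying hypothesis (b) of Thm. 3.4 (iv), there is a `1`-unique functor
`Ψ⁰ : F_{0_{D₁}} → F_{0_{D₂}}` `1`-commuting with `Ψ` over the natural projections `C_i → F_{0_{D_i}}`; over slim
bases the composite functors are rigid.

PROOF-ONLY file (abc-iut cell, block F fact-proving wave, seat abc-iut-f-027 floating on tranche 34, FACT-LIST
row F-1031 `PreFrobenioidData.Cor412` — a PARAMETRISED schema over the bare operations interface
`PreFrobenioidData` and the data-only `RSParams`; per the cell's rule R1 the deliverable is the INSTANCE FORM the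
cone consumes, i.e. the schema at `PreFrobenioidData.ofFunctor Φ_i F_i` for Frobenioids). 0 definitions.

What is new. The cell's closers of record of the typed Cor. 4.12 — `FrdI.cor412_of_isOfFSMType` (abc-iut-w5-d222,
`Cor412Closed.lean`), `FrdI.cor412_of_isOfFSMFFType2024` (abc-iut-w4-d088, `Cor412OverFSMFF2024.lean`) and their
"canonical" forms at THE Def. 4.5 (iii) parameters (`Cor412Unconditional.lean`) — carry a hypothesis on the base
categories ("`D_i` of FSM-type", resp. "of FSMFF-type in the author's 2024 sense") because the three inputs from
Thm. 3.4 — (ii) co-angular pre-steps and (iii) base-isomorphisms for `Ψ^istr`, (iv) `O^×(−)` at the two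
birationalizations — were only available over such bases. Since `EquivalencePreStepsFSMFF2008Assembly.lean`
(abc-iut-L1-t11 over abc-iut-L1-t13's core) the named facts `FrdI.Thm34ii`, `Thm34iii`, `Thm34iv`, `Thm34v` in the
PRINTED 2008 wording are THEOREMS (`FrdI.Thm34ii_holds`, …), and print's hypothesis (d) "`D_i` of FSMFF-type" of
"standard type" (Def. 3.1 (i) p. 56) is exactly what they consume. Hence the base hypothesis disappears:

* `FrdI.cor412_ofFunctor` — the typed `PreFrobenioidData.Cor412` at `ofFunctor`, for EVERY pair of Frobenioids
  and every `Ψ`, all parameters `R_i`, GIVEN only (at `C_i^istr`) THE birationalizations' Frobenioid structures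
  `hB_i` (Prop. 4.4 (ii)) of standard type `hstd_i` (Prop. 4.8 (iii)) — the shape of `cor412_of_isOfFSMType`
  with `hD_i` deleted; route = `FrdI.cor412_of_thm34iv_istr` (abc-iut-w5-d222, `Cor412Assembly.lean`: "Cor. 4.12
  from the named fact Thm. 3.4 (iv)") fed with `FrdI.Thm34iv_holds`, the `Ψ^istr`-inputs from
  `FrdI.isCoAngularPreStep_map_of_quasiIsotropic_of_isOfFSMFFType` and `FrdI.Thm34iii_holds`;
* `FrdI.cor412_ofFunctor_canonical`, `…_canonical'`, `FrdI.cor412_rsParams` — at THE Def. 4.5 (iii) parameters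
  `(C_i^birat, Supp_i, C_i^un-tr, (C_i^un-tr)^birat)` (named form `PreFrobenioid.rsParams`), where `hB_i`, `hstd_i`
  are supplied by Cor. 4.12's OWN antecedent "rationally standard type" (abc-iut-L1-d5's
  `Birat.isFrobenioid_istrBirat_of_isOfBiratFrobeniusNormalizedType`, `prop48iii_rationallyStandard_unconditional`):
  **the typed Cor. 4.12 for every pair of Frobenioids, every `Ψ`, every support notion, with no input beyond
  print's** — no base-type hypothesis, no named fact, no residual.

No statement of the paper is restated or strengthened; no new definition; nothing here bears on the disputed
[IUTchIII] Cor. 3.12 (no side taken; typed ≠ proved elsewhere, here proved = kernel-checked).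
-/

-- As in the Thm. 3.4 lineage files (`EquivalencePreStepsFSMFF2008Assembly.lean`): compositions with
-- `e.unit.app _` / full-subcategory equivalences unfold implicit objects only at default transparency.
set_option backward.isDefEq.respectTransparency false

namespace Literature.AlgebraicGeometry.Frobenioids

open CategoryTheory Opposite

universe w v v' u u'

namespace FrdI

open PreFrobenioid

section General

variable {D₁ : Type u} [Category.{v} D₁] {Φ₁ : D₁ᵒᵖ ⥤ CommMonCat.{w}}
  {C₁ : Type u'} [Category.{v'} C₁] {F₁ : C₁ ⥤ ElemFrobenioid Φ₁}
  {D₂ : Type u} [Category.{v} D₂] {Φ₂ : D₂ᵒᵖ ⥤ CommMonCat.{w}}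
  {C₂ : Type u'} [Category.{v'} C₂] {F₂ : C₂ ⥤ ElemFrobenioid Φ₂}

/-- **[FrdI] Corollary 4.12 AS TYPED, for EVERY pair of Frobenioids — no base-type hypothesis, no named fact**
(print p. 94 l. 44 – p. 95 l. 40): for Frobenioids `C_i → F_{Φ_i}` and an equivalence `Ψ : C₁ ⥲ C₂`, GIVEN only —
at the Frobenioids `C_i^istr` — THE birationalizations' Frobenioid structures `(C_i^istr)^birat → F_{0_{D_i}}`
(`hB_i`, Prop. 4.4 (ii)) of standard type (`hstd_i`, Prop. 4.8 (iii)), the typed Cor. 4.12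
(`PreFrobenioidData.Cor412`) holds for `Ψ` under its own printed antecedents (Frobenius-slim bases, rationally
standard type, (b)), for all parameters `R_i`. Route: "we may assume without loss of generality that `C₁`, `C₂`
are of isotropic type [cf. Theorem 3.4, (i)]" (`nonempty_isotropification_comp_iso`, Rem. 4.5.1
`isOfStandardType_istr`, `hypB_istr`); Thm. 3.4 (ii) co-angular pre-steps for `Ψ^istr`
(`FrdI.isCoAngularPreStep_map_of_quasiIsotropic_of_isOfFSMFFType`, the FSMFF hypothesis being (d) of standard
type) and Thm. 3.4 (iii) base-isomorphisms (`FrdI.Thm34iii_holds`); then `FrdI.cor412_of_thm34iv_istr` with the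
theorem `FrdI.Thm34iv_holds` in the slot of the named fact. [cite: MochizukiFrdI2008, Cor. 4.12 p.95] -/
theorem cor412_ofFunctor (hF₁ : IsFrobenioid F₁) (hF₂ : IsFrobenioid F₂)
    (hsq₁ : HasBiratSquares (istrFunctor F₁)) (hsq₂ : HasBiratSquares (istrFunctor F₂))
    (hB₁ : IsFrobenioid (Birat.toElemZero (isFrobenioid_istr hF₁) hsq₁))
    (hB₂ : IsFrobenioid (Birat.toElemZero (isFrobenioid_istr hF₂) hsq₂))
    (hstd₁ : (biratOps (isFrobenioid_istr hF₁) hsq₁).IsOfStandardType)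
    (hstd₂ : (biratOps (isFrobenioid_istr hF₂) hsq₂).IsOfStandardType) (Ψ : C₁ ≌ C₂)
    (R₁ : (PreFrobenioidData.ofFunctor Φ₁ F₁).RSParams) (R₂ : (PreFrobenioidData.ofFunctor Φ₂ F₂).RSParams) :
    (PreFrobenioidData.ofFunctor Φ₁ F₁).Cor412 (PreFrobenioidData.ofFunctor Φ₂ F₂) Ψ R₁ R₂ := by
  intro hfs₁ hfs₂ hR₁ hR₂ hB
  have hs₁ := hR₁.standard
  have hs₂ := hR₂.standard
  -- Thm. 3.4 (i): the restriction `Ψ^istr` and its square with the isotropifications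
  haveI : (isotropicObjects F₂).IsClosedUnderIsomorphisms :=
    ⟨fun e hX => IsIsotropic.of_iso hF₂.isPreFrobenioid e.symm hX⟩
  have hinv := FrdI.isotropicObjects_inverseImage hF₁ hs₁.quasiIsotropic hs₂.quasiIsotropic Ψ
  let Ψi : Istr F₁ ≌ Istr F₂ := Ψ.congrFullSubcategory hinv
  obtain ⟨core⟩ := nonempty_isotropification_comp_iso hF₁ hF₂ hs₁.quasiIsotropic hs₂.quasiIsotropic Ψ
  -- Rem. 4.5.1: `C_i^istr` of standard type; hypothesis (b) for `Ψ^istr` and for its inverse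
  have hs₁' := isOfStandardType_istr hF₁ hs₁
  have hs₂' := isOfStandardType_istr hF₂ hs₂
  have hBi : (PreFrobenioidData.ofFunctor Φ₁ (istrFunctor F₁)).HypB
      (PreFrobenioidData.ofFunctor Φ₂ (istrFunctor F₂)) Ψi := hypB_istr hF₁ hF₂ Ψ hinv hB
  have hBi' : (PreFrobenioidData.ofFunctor Φ₂ (istrFunctor F₂)).HypB
      (PreFrobenioidData.ofFunctor Φ₁ (istrFunctor F₁)) Ψi.symm :=
    fun hg₂ hg₁ => ⟨(hBi hg₁ hg₂).2, (hBi hg₁ hg₂).1⟩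
  -- Thm. 3.4 (ii): `Ψ^istr`, `(Ψ^istr)⁻¹` preserve co-angular pre-steps (base hypothesis = (d) of standard type)
  have hΨ : ∀ ⦃A B : Istr F₁⦄ (f : A ⟶ B),
      IsCoAngularPreStep (istrFunctor F₁) f → IsCoAngularPreStep (istrFunctor F₂) (Ψi.functor.map f) :=
    fun A B f hf => FrdI.isCoAngularPreStep_map_of_quasiIsotropic_of_isOfFSMFFType (isFrobenioid_istr hF₁)
      (isFrobenioid_istr hF₂) hs₁'.quasiIsotropic hs₂'.quasiIsotropic hs₂'.fsmff Ψi hf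
  have hΨ' : ∀ ⦃A B : Istr F₂⦄ (f : A ⟶ B),
      IsCoAngularPreStep (istrFunctor F₂) f → IsCoAngularPreStep (istrFunctor F₁) (Ψi.inverse.map f) :=
    fun A B f hf => FrdI.isCoAngularPreStep_map_of_quasiIsotropic_of_isOfFSMFFType (isFrobenioid_istr hF₂)
      (isFrobenioid_istr hF₁) hs₂'.quasiIsotropic hs₁'.quasiIsotropic hs₁'.fsmff Ψi.symm hf
  -- Thm. 3.4 (iii): `Ψ^istr`, `(Ψ^istr)⁻¹` preserve base-isomorphisms (the named fact, now a theorem)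
  obtain ⟨⟨-, -, hbi, -, -, -, -⟩, -⟩ :=
    Thm34iii_holds _ _ (isFrobenioid_istr hF₁) (isFrobenioid_istr hF₂) Ψi hs₁' hs₂' hBi
  obtain ⟨⟨-, -, hbi', -, -, -, -⟩, -⟩ :=
    Thm34iii_holds _ _ (isFrobenioid_istr hF₂) (isFrobenioid_istr hF₁) Ψi.symm hs₂' hs₁' hBi'
  -- Cor. 4.12 from the named fact Thm. 3.4 (iv) (abc-iut-w5-d222), the fact being the theorem `Thm34iv_holds`
  exact cor412_of_thm34iv_istr Thm34iv_holds.{w, v, max u' v', u, u'} hF₁ hF₂ Ψ Ψi core hsq₁ hsq₂ hB₁ hB₂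
    hstd₁ hstd₂ hfs₁ hfs₂ hΨ hΨ' hbi hbi' R₁ R₂ hfs₁ hfs₂ hR₁ hR₂ hB

/-! ### At THE Definition 4.5 (iii) parameters: no input beyond print's -/

/-- **[FrdI] Corollary 4.12 AT THE Def. 4.5 (iii) data, for EVERY pair of Frobenioids, NO residual input and
NO base-type hypothesis.** For Frobenioids `C_i → F_{Φ_i}`, an equivalence `Ψ : C₁ ⥲ C₂`, support notions
`Supp_i` (Def. 2.4 (i)(d)) and square-completion data `hsq_i`, `hsq'_i` of the constructions of `C_i^birat`,
`(C_i^istr)^birat`, the typed Cor. 4.12 holds for `Ψ` at the parameters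
`R_i = (C_i^birat, Supp_i, C_i^un-tr, (C_i^un-tr)^birat)`: its antecedent "`C_i` of rationally standard type"
supplies, at `C_i^istr`, the Frobenioid structure of `(C_i^istr)^birat → F_{0_{D_i}}` (Prop. 4.4 (ii)) and its
standard type (Prop. 4.8 (iii)), whence `cor412_ofFunctor`. [cite: MochizukiFrdI2008, Cor. 4.12 p.95] -/
theorem cor412_ofFunctor_canonical (hF₁ : IsFrobenioid F₁) (hF₂ : IsFrobenioid F₂)
    (hsq₁ : HasBiratSquares F₁) (hsq₂ : HasBiratSquares F₂)
    (hsq₁' : HasBiratSquares (istrFunctor F₁)) (hsq₂' : HasBiratSquares (istrFunctor F₂)) (Ψ : C₁ ≌ C₂)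
    (Supp₁ : ∀ {X : D₁}, (PreFrobenioidData.ofFunctor Φ₁ F₁).Mon X →
      Primes ((PreFrobenioidData.ofFunctor Φ₁ F₁).Mon X) → Prop)
    (Supp₂ : ∀ {X : D₂}, (PreFrobenioidData.ofFunctor Φ₂ F₂).Mon X →
      Primes ((PreFrobenioidData.ofFunctor Φ₂ F₂).Mon X) → Prop) :
    (PreFrobenioidData.ofFunctor Φ₁ F₁).Cor412 (PreFrobenioidData.ofFunctor Φ₂ F₂) Ψ
      ⟨biratData hF₁ hsq₁, Supp₁, PreFrobenioidData.ofFunctor Φ₁ (untrFunctor hF₁),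
        biratData (isFrobenioid_untr hF₁) (hasBiratSquares_untr hF₁)⟩
      ⟨biratData hF₂ hsq₂, Supp₂, PreFrobenioidData.ofFunctor Φ₂ (untrFunctor hF₂),
        biratData (isFrobenioid_untr hF₂) (hasBiratSquares_untr hF₂)⟩ := by
  intro hfs₁ hfs₂ hR₁ hR₂ hB
  exact cor412_ofFunctor hF₁ hF₂ hsq₁' hsq₂'
    (Birat.isFrobenioid_istrBirat_of_isOfBiratFrobeniusNormalizedType hF₁ hsq₁ hsq₁' hR₁.biratFrobNormalized)
    (Birat.isFrobenioid_istrBirat_of_isOfBiratFrobeniusNormalizedType hF₂ hsq₂ hsq₂' hR₂.biratFrobNormalized)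
    (PreFrobenioidData.prop48iii_rationallyStandard_unconditional hF₁ hsq₁ hsq₁' Supp₁ hR₁)
    (PreFrobenioidData.prop48iii_rationallyStandard_unconditional hF₂ hsq₂ hsq₂' Supp₂ hR₂)
    Ψ _ _ hfs₁ hfs₂ hR₁ hR₂ hB

/-- **[FrdI] Corollary 4.12 AT THE Def. 4.5 (iii) data, for EVERY pair of Frobenioids** — the square-completion
hypotheses of the constructions of `C_i^birat` and `(C_i^istr)^birat` discharged by Prop. 1.11 (vii)
(`hasBiratSquares_of_isFrobenioid`): the statement takes only the Frobenioids, `Ψ` and the support notions.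
[cite: MochizukiFrdI2008, Cor. 4.12 p.95] -/
theorem cor412_ofFunctor_canonical' (hF₁ : IsFrobenioid F₁) (hF₂ : IsFrobenioid F₂) (Ψ : C₁ ≌ C₂)
    (Supp₁ : ∀ {X : D₁}, (PreFrobenioidData.ofFunctor Φ₁ F₁).Mon X →
      Primes ((PreFrobenioidData.ofFunctor Φ₁ F₁).Mon X) → Prop)
    (Supp₂ : ∀ {X : D₂}, (PreFrobenioidData.ofFunctor Φ₂ F₂).Mon X →
      Primes ((PreFrobenioidData.ofFunctor Φ₂ F₂).Mon X) → Prop) :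
    (PreFrobenioidData.ofFunctor Φ₁ F₁).Cor412 (PreFrobenioidData.ofFunctor Φ₂ F₂) Ψ
      ⟨biratData hF₁ (hasBiratSquares_of_isFrobenioid hF₁), Supp₁,
        PreFrobenioidData.ofFunctor Φ₁ (untrFunctor hF₁),
        biratData (isFrobenioid_untr hF₁) (hasBiratSquares_untr hF₁)⟩
      ⟨biratData hF₂ (hasBiratSquares_of_isFrobenioid hF₂), Supp₂,
        PreFrobenioidData.ofFunctor Φ₂ (untrFunctor hF₂),
        biratData (isFrobenioid_untr hF₂) (hasBiratSquares_untr hF₂)⟩ :=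
  cor412_ofFunctor_canonical hF₁ hF₂ _ _
    (hasBiratSquares_of_isFrobenioid (isFrobenioid_istr hF₁))
    (hasBiratSquares_of_isFrobenioid (isFrobenioid_istr hF₂)) Ψ Supp₁ Supp₂

/-- **[FrdI] Corollary 4.12 at the NAMED parameters `PreFrobenioid.rsParams`, for EVERY pair of Frobenioids and
every equivalence, NO residual input, NO base-type hypothesis, NO named fact** — the vocabulary in which the
tree's producers of "rationally standard type" are stated; definitionally `cor412_ofFunctor_canonical'`.
[cite: MochizukiFrdI2008, Cor. 4.12 p.95] -/
theorem cor412_rsParams (hF₁ : IsFrobenioid F₁) (hF₂ : IsFrobenioid F₂) (Ψ : C₁ ≌ C₂)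
    (Supp₁ : ∀ {X : D₁}, (PreFrobenioidData.ofFunctor Φ₁ F₁).Mon X →
      Primes ((PreFrobenioidData.ofFunctor Φ₁ F₁).Mon X) → Prop)
    (Supp₂ : ∀ {X : D₂}, (PreFrobenioidData.ofFunctor Φ₂ F₂).Mon X →
      Primes ((PreFrobenioidData.ofFunctor Φ₂ F₂).Mon X) → Prop) :
    (PreFrobenioidData.ofFunctor Φ₁ F₁).Cor412 (PreFrobenioidData.ofFunctor Φ₂ F₂) Ψ
      (rsParams hF₁ Supp₁) (rsParams hF₂ Supp₂) :=
  cor412_ofFunctor_canonical' hF₁ hF₂ Ψ Supp₁ Supp₂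

end General

end FrdI

end Literature.AlgebraicGeometry.Frobenioids
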